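import Mathlib
import Summits.NavierStokesRegularity.NavierStokesRegularity.Theorems.TaoLadderRungTwoBreakBlowupRigidityOneSmallEnvelope
import Literature.Analysis.FluidPDE.Tao2016AveragedNS.ViscousEnvelopeSmoothing
import HarnessLib

/-!
# Small one-shell data of the NS-damped cascade lattice are globally regular: the sub-threshold geometric envelope
  PERSISTS along every regular viscous solution (continuous induction over the fence `envelope_improves`), hence the
  BMR smoothing applies — the small-critical-data regularity behind any absorber construction for the survival step
  (E2) of `stub_eternalFromBlowup` (K2(1) `TaoLadderRungTwoBreak.BlowupRigidityOne`, stmt-NavierStokesRegularity-20206)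

MODEL lattice ODEs only (Tao 2016 §4 Lemma 4.1 (4.5), (4.8) and the viscous lattice before Thm. 4.2); nothing here is
a statement about the Navier–Stokes equations; NO item is closed (`--supports stmt-NavierStokesRegularity-20206`).
Route-independent module; general `m`; DEF-FREE.

* `envelope_of_lowShells` — bookkeeping: the envelope `|X_{i,k}(t)| ≤ δ(1+ε₀)^{-9k}` at a time `t` holds on ALL
  shells as soon as it holds on the finitely many shells `0 ≤ k < K₀`, where `(1+ε₀)^{K₀} ≥ M/δ` and `M` is the
  solution's (4.5)-weight bound (high shells are small by (4.5), negative shells vanish);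
* `envelope_persists` — **PERSISTENCE.** For `ε₀ > 0`, `|α| ≤ M_α`, `0 < δ` with `8m²M_α(1+ε₀)^{16}δ < ν`, every
  regular solution of the `ν`-viscous lattice on `[0,s]` from a one-shell datum with `|X₀ᵢ| ≤ δ/2` (continuous,
  (4.5)-bounded, no shells below `0` — the solution class of the tree's continuation theorems) obeys
  `|X_{i,k}(t)| ≤ δ(1+ε₀)^{-9k}` for all `t ∈ [0,s]`, all modes and shells. Proof: continuous induction on
  `τ* = sup {τ ≤ s : envelope on [0,τ]}` — closed by continuity, re-opened by the fence `envelope_improves`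
  (`δ ↦ δ/2` on `[0,τ*]`) plus continuity of the finitely many low shells.

* `exists_viscousGlobal_of_smallDatum` — **SMALL ONE-SHELL DATA OF THE DAMPED LATTICE ARE GLOBALLY REGULAR**
  (Kato-type, sign-free, any table with `|α| ≤ M_α`, any `ε₀ > 0`, `ν > 0`): `|X₀ᵢ| ≤ δ/2` with
  `8m²M_α(1+ε₀)^{16}δ < ν` ⇒ `∃ X, ViscousGlobal ε₀ ν α X₀ X` — the persistent envelope gives the subcritical
  tail-energy envelope `Σ_{k=n}^{N} Σ_i ½X_{i,k}² ≤ (m/2)δ²(1−(1+ε₀)^{-18})⁻¹ (1+ε₀)^{-18n}` on every window, and the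
  tree's BMR smoothing + continuation theorem `exists_viscousGlobal_of_subcriticalEnvelope` concludes.

The scale-free reading (`noGlobalCascade_datumScale_iff`): what is small is `|X₀|/ν`; the theorem does not bear on the
robustness of a fixed datum (all budgets `κ → 0`) — it is the regularity engine an absorber / gain-field construction
(`hasGlobal_of_gainField`) needs once a blow-up front has thinned out below the dissipation threshold. HONEST LABEL:
a priori estimates and a small-data theorem for the damped MODEL lattice; no stub, crux or summit is proved; rung 0.
-/

noncomputable section

-- the summit and its single sub-problem share the name (CONVENTIONS §1)
set_option linter.dupNamespace false

open Set Filter Topology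

namespace Summit.NavierStokesRegularity.NavierStokesRegularity.Theorems

namespace BlowupRigidityOne

open Literature.Analysis.FluidPDE Literature.Analysis.FluidPDE.TaoCascade

variable {m : ℕ}

/-- **High shells are small by the a priori weight, negative shells vanish.** If `(1 + (1+ε₀)^{10k})|X_{i,k}(t)| ≤ M`
for all `i, k`, `X_{i,k}(t) = 0` for `k < 0`, `δ > 0` and `M ≤ δ (1+ε₀)^{K₀}`, then the envelope
`|X_{i,k}(t)| ≤ δ(1+ε₀)^{-9k}` on the shells `0 ≤ k < K₀` extends to all shells `k ∈ ℤ`.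
[cite: Tao2016AveragedNS, §4 Lemma 4.1 (4.5), (4.11)] -/
theorem envelope_of_lowShells {ε₀ δ M : ℝ} (hε : 0 < ε₀) (hδ : 0 < δ) {K₀ : ℕ}
    (hK₀ : M ≤ δ * (1 + ε₀) ^ (K₀ : ℝ)) {X : Fin m → ℤ → ℝ → ℝ} {t : ℝ}
    (hapr : ∀ (i : Fin m) (k : ℤ), (1 + (1 + ε₀) ^ ((10 : ℝ) * k)) * |X i k t| ≤ M)
    (hneg : ∀ (i : Fin m) (k : ℤ), k < 0 → X i k t = 0)
    (hlow : ∀ (i : Fin m) (k : ℕ), k < K₀ → |X i (k : ℤ) t| ≤ δ * (1 + ε₀) ^ (-((9 : ℝ) * ((k : ℤ) : ℝ)))) :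
    ∀ (i : Fin m) (k : ℤ), |X i k t| ≤ δ * (1 + ε₀) ^ (-((9 : ℝ) * k)) := by
  intro i k
  have hb : 0 < 1 + ε₀ := by linarith
  have hb1 : 1 ≤ 1 + ε₀ := by linarith
  rcases lt_or_ge k 0 with hk | hk
  · rw [hneg i k hk, abs_zero]; positivity
  obtain ⟨n, rfl⟩ := Int.eq_ofNat_of_zero_le hk
  rcases lt_or_ge n K₀ with hn | hn
  · exact hlow i n hn
  -- high shell: `|X| ≤ M (1+ε₀)^{-10n} ≤ δ (1+ε₀)^{-9n}`
  have hp10 : 0 < (1 + ε₀) ^ ((10 : ℝ) * ((n : ℤ) : ℝ)) := Real.rpow_pos_of_pos hb _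
  have h1 : (1 + ε₀) ^ ((10 : ℝ) * ((n : ℤ) : ℝ)) * |X i n t| ≤ M := by
    have := hapr i n
    nlinarith [abs_nonneg (X i (n : ℤ) t)]
  have hM : M ≤ δ * (1 + ε₀) ^ (((n : ℤ) : ℝ)) := by
    refine hK₀.trans (mul_le_mul_of_nonneg_left ?_ hδ.le)
    exact Real.rpow_le_rpow_of_exponent_le hb1 (by exact_mod_cast hn)
  -- combine: (1+ε₀)^{10n}|X| ≤ δ (1+ε₀)^{n}, i.e. |X| ≤ δ (1+ε₀)^{-9n}
  have hsplit : (1 + ε₀) ^ ((10 : ℝ) * ((n : ℤ) : ℝ))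
      = (1 + ε₀) ^ (((n : ℤ) : ℝ)) * (1 + ε₀) ^ ((9 : ℝ) * ((n : ℤ) : ℝ)) := by
    rw [← Real.rpow_add hb]; congr 1; ring
  have hinv : (1 + ε₀) ^ (-((9 : ℝ) * ((n : ℤ) : ℝ))) = ((1 + ε₀) ^ ((9 : ℝ) * ((n : ℤ) : ℝ)))⁻¹ :=
    Real.rpow_neg hb.le _
  have hp9 : 0 < (1 + ε₀) ^ ((9 : ℝ) * ((n : ℤ) : ℝ)) := Real.rpow_pos_of_pos hb _
  have hp1 : 0 < (1 + ε₀) ^ (((n : ℤ) : ℝ)) := Real.rpow_pos_of_pos hb _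
  rw [hinv, ← div_eq_mul_inv, le_div_iff₀ hp9]
  rw [hsplit] at h1
  nlinarith [h1, hM, hp1, hp9, abs_nonneg (X i (n : ℤ) t)]

/-- **PERSISTENCE OF THE SUB-THRESHOLD ENVELOPE (a priori estimate for small one-shell data).** Let `ε₀ > 0`,
`|α| ≤ M_α`, `0 < δ` with `8 m² M_α (1+ε₀)^{16} δ < ν`, and `|X₀ᵢ| ≤ δ/2`. Let `X` be a regular solution of the
`ν`-viscous lattice on `[0,s]` from the one-shell datum `X₀` at shell `0`: continuous shell-wise, vanishing below shell
`0`, (4.5)-bounded (`sup_{t,i,k} (1+(1+ε₀)^{10k})|X_{i,k}(t)| < ∞`), with the viscous law as one-sided derivatives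
within `[0,s]`. Then `|X_{i,k}(t)| ≤ δ(1+ε₀)^{-9k}` for all `t ∈ [0,s]`, `i`, `k`.
[cite: Tao2016AveragedNS, §4 Lemma 4.1 (4.5), (4.8), (4.11) and the viscous lattice before Thm. 4.2; BarbatoMorandinRomito2011, §3.1 Prop. 3.3 (invariant region)] -/
theorem envelope_persists {ε₀ ν Mα δ s : ℝ} (hε : 0 < ε₀) (hδ : 0 < δ)
    {α : Fin m → Fin m → Fin m → ℤ × ℤ × ℤ → ℝ} (hα : ∀ i₁ i₂ i₃ μ, |α i₁ i₂ i₃ μ| ≤ Mα)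
    (hsmall : 8 * (m : ℝ) ^ 2 * Mα * (1 + ε₀) ^ (16 : ℝ) * δ < ν)
    {X₀ : Fin m → ℝ} (hX₀ : ∀ i, |X₀ i| ≤ δ / 2)
    {X : Fin m → ℤ → ℝ → ℝ} (hs : 0 ≤ s)
    (hinit : ∀ i k, X i k 0 = if k = 0 then X₀ i else 0)
    (hnoLow : ∀ i k, k < 0 → ∀ t, X i k t = 0)
    (hapriori : ∃ M : ℝ, ∀ (t : ℝ) (i : Fin m) (k : ℤ), (1 + (1 + ε₀) ^ ((10 : ℝ) * k)) * |X i k t| ≤ M)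
    (hcontR : ∀ i k, Continuous (X i k))
    (hderiv : ∀ i k, ∀ t ∈ Icc 0 s, HasDerivWithinAt (X i k)
      (quadTerm ε₀ α X i k t - ν * (1 + ε₀) ^ ((2 : ℝ) * k) * X i k t) (Icc 0 s) t) :
    ∀ (i : Fin m) (k : ℤ), ∀ t ∈ Icc 0 s, |X i k t| ≤ δ * (1 + ε₀) ^ (-((9 : ℝ) * k)) := by
  have hb : 0 < 1 + ε₀ := by linarith
  have hb1' : 1 < 1 + ε₀ := by linarith
  obtain ⟨M, hM⟩ := hapriori
  -- a shell index beyond which the a priori weight gives the envelope for free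
  obtain ⟨K₀, hK₀⟩ : ∃ K₀ : ℕ, M ≤ δ * (1 + ε₀) ^ (K₀ : ℝ) := by
    obtain ⟨K₀, hK⟩ := pow_unbounded_of_one_lt (M / δ) hb1'
    refine ⟨K₀, ?_⟩
    rw [Real.rpow_natCast]
    have := (div_lt_iff₀' hδ).1 hK
    exact this.le
  -- the envelope at a time from its low-shell part
  have hall : ∀ t, (∀ (i : Fin m) (k : ℕ), k < K₀ → |X i (k : ℤ) t| ≤ δ * (1 + ε₀) ^ (-((9 : ℝ) * ((k : ℤ) : ℝ)))) →
      ∀ (i : Fin m) (k : ℤ), |X i k t| ≤ δ * (1 + ε₀) ^ (-((9 : ℝ) * k)) := fun t hlow =>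
    envelope_of_lowShells hε hδ hK₀ (fun i k => hM t i k) (fun i k hk => hnoLow i k hk t) hlow
  -- the envelope at time 0
  have h0env : ∀ (i : Fin m) (k : ℤ), |X i k 0| ≤ δ * (1 + ε₀) ^ (-((9 : ℝ) * k)) := by
    intro i k
    rw [hinit i k]
    split_ifs with hk
    · subst hk
      simp only [Int.cast_zero, mul_zero, neg_zero, Real.rpow_zero, mul_one]
      linarith [hX₀ i]
    · rw [abs_zero]; positivity
  -- continuous induction
  set S : Set ℝ := {τ | τ ∈ Icc 0 s ∧ ∀ (i : Fin m) (k : ℤ), ∀ t ∈ Icc 0 τ,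
    |X i k t| ≤ δ * (1 + ε₀) ^ (-((9 : ℝ) * k))} with hS
  have h0S : (0 : ℝ) ∈ S := by
    refine ⟨⟨le_rfl, hs⟩, fun i k t ht => ?_⟩
    have : t = 0 := le_antisymm ht.2 ht.1
    rw [this]; exact h0env i k
  have hne : S.Nonempty := ⟨0, h0S⟩
  have hbdd : BddAbove S := ⟨s, fun τ hτ => hτ.1.2⟩
  set τs := sSup S with hτs
  have hτs0 : 0 ≤ τs := le_csSup hbdd h0S
  have hτss : τs ≤ s := csSup_le hne fun τ hτ => hτ.1.2
  -- envelope on `[0, τs)`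
  have hbelow : ∀ t, 0 ≤ t → t < τs → ∀ (i : Fin m) (k : ℤ), |X i k t| ≤ δ * (1 + ε₀) ^ (-((9 : ℝ) * k)) := by
    intro t ht0 ht i k
    obtain ⟨τ, hτS, htτ⟩ := exists_lt_of_lt_csSup hne ht
    exact hτS.2 i k t ⟨ht0, htτ.le⟩
  -- envelope at `τs` by closedness
  have hat : ∀ (i : Fin m) (k : ℤ), |X i k τs| ≤ δ * (1 + ε₀) ^ (-((9 : ℝ) * k)) := by
    intro i k
    rcases hτs0.eq_or_lt with h0 | hpos
    · rw [← h0]; exact h0env i k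
    · have hclosed : IsClosed {t | |X i k t| ≤ δ * (1 + ε₀) ^ (-((9 : ℝ) * k))} :=
        isClosed_le (hcontR i k).abs continuous_const
      have hsub : Ico 0 τs ⊆ {t | |X i k t| ≤ δ * (1 + ε₀) ^ (-((9 : ℝ) * k))} :=
        fun t ht => hbelow t ht.1 ht.2 i k
      have hcl := hclosed.closure_subset_iff.2 hsub
      rw [closure_Ico hpos.ne] at hcl
      exact hcl ⟨hτs0, le_rfl⟩
  have hτsS : τs ∈ S := by
    refine ⟨⟨hτs0, hτss⟩, fun i k t ht => ?_⟩
    rcases ht.2.eq_or_lt with h | h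
    · rw [h]; exact hat i k
    · exact hbelow t ht.1 h i k
  -- if `τs = s` we are done
  rcases hτss.eq_or_lt with hEq | hlt
  · intro i k t ht
    rw [← hEq] at ht
    exact hτsS.2 i k t ht
  -- otherwise re-open with the fence on `[0, τs]`
  exfalso
  have hderiv' : ∀ i k, ∀ t ∈ Icc 0 τs, HasDerivWithinAt (X i k)
      (quadTerm ε₀ α X i k t - ν * (1 + ε₀) ^ ((2 : ℝ) * k) * X i k t) (Icc 0 τs) t :=
    fun i k t ht => (hderiv i k t ⟨ht.1, ht.2.trans hτss⟩).mono (Icc_subset_Icc_right hτss)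
  have himp := envelope_improves (s := τs) hε hδ hα hsmall hX₀ hinit hnoLow
    (fun i k => (hcontR i k).continuousOn) hderiv' hτsS.2
  -- low shells stay strictly inside for a while after `τs`
  have hev : ∀ᶠ t in 𝓝 τs, ∀ (i : Fin m) (k : Fin K₀),
      |X i ((k : ℕ) : ℤ) t| < δ * (1 + ε₀) ^ (-((9 : ℝ) * (((k : ℕ) : ℤ) : ℝ))) := by
    refine eventually_all.2 fun i => eventually_all.2 fun k => ?_
    refine ((hcontR i ((k : ℕ) : ℤ)).abs.continuousAt).eventually_lt continuousAt_const ?_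
    have h1 := himp i ((k : ℕ) : ℤ) τs ⟨hτs0, le_rfl⟩
    have hpos : 0 < δ * (1 + ε₀) ^ (-((9 : ℝ) * (((k : ℕ) : ℤ) : ℝ))) :=
      mul_pos hδ (Real.rpow_pos_of_pos hb _)
    linarith
  obtain ⟨η, hη, hball⟩ := Metric.eventually_nhds_iff.1 hev
  -- the time `τ' = min s (τs + η/2)` lies in `S` and beyond `τs`
  set τ' := min s (τs + η / 2) with hτ'
  have hτ'gt : τs < τ' := lt_min hlt (by linarith)
  have hτ'S : τ' ∈ S := by
    refine ⟨⟨hτs0.trans hτ'gt.le, min_le_left _ _⟩, fun i k t ht => ?_⟩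
    rcases le_or_gt t τs with hle | hgt
    · exact hτsS.2 i k t ⟨ht.1, hle⟩
    · refine hall t (fun i' k' hk' => ?_) i k
      have hdist : dist t τs < η := by
        rw [Real.dist_eq, abs_of_pos (by linarith)]
        have : t ≤ τs + η / 2 := ht.2.trans (min_le_right _ _)
        linarith
      exact (hball hdist i' ⟨k', hk'⟩).le
  exact absurd (le_csSup hbdd hτ'S) (not_le.2 hτ'gt)

/-- **SMALL ONE-SHELL DATA OF THE DAMPED LATTICE ARE GLOBALLY REGULAR** (Kato-type small-data theorem for Tao's
model lattice with NS-scaled dissipation; sign-free, general table). For `ε₀ > 0`, `ν > 0`, structure constants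
`|α| ≤ M_α` and a one-shell datum with `|X₀ᵢ| ≤ δ/2`, `8 m² M_α (1+ε₀)^{16} δ < ν`, the `ν`-viscous lattice has a
GLOBAL REGULAR solution from `X₀` (`ViscousGlobal ε₀ ν α X₀ X`): the persistent envelope `δ(1+ε₀)^{-9k}`
(`envelope_persists`) gives the subcritical tail-energy envelope `Σ_{k ≥ n} Σ_i ½X_{i,k}² ≤ C(1+ε₀)^{-18n}` on every
window, and the tree's smoothing + continuation theorem `exists_viscousGlobal_of_subcriticalEnvelope` (BMR bootstrap)
concludes. By `hasGlobal_of_viscousGlobal` such data carry a global `(ν√2,0)`-pseudo-solution; this does NOT bear on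
robustness of a fixed datum (which asks all budgets `κ → 0`; robust blow-up is 0-homogeneous in the datum,
`noGlobalCascade_datumScale_iff`) — it is the regularity engine for absorber constructions from thinned-out states.
[cite: Tao2016AveragedNS, §4 Lemma 4.1 (4.5)–(4.11) and the viscous lattice before Thm. 4.2; BarbatoMorandinRomito2011, §3.1 Prop. 3.3, §3.2] -/
theorem exists_viscousGlobal_of_smallDatum {ε₀ ν Mα δ : ℝ} (hε : 0 < ε₀) (hν : 0 < ν) (hMα : 0 ≤ Mα)
    (hδ : 0 < δ) {α : Fin m → Fin m → Fin m → ℤ × ℤ × ℤ → ℝ} (hα : ∀ i₁ i₂ i₃ μ, |α i₁ i₂ i₃ μ| ≤ Mα)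
    (hsmall : 8 * (m : ℝ) ^ 2 * Mα * (1 + ε₀) ^ (16 : ℝ) * δ < ν)
    {X₀ : Fin m → ℝ} (hX₀ : ∀ i, |X₀ i| ≤ δ / 2) :
    ∃ X : Fin m → ℤ → ℝ → ℝ, ViscousGlobal ε₀ ν α X₀ X := by
  have hb : 0 < 1 + ε₀ := by linarith
  have hb1' : 1 < 1 + ε₀ := by linarith
  -- the geometric ratio of the tail energies
  set r : ℝ := (1 + ε₀) ^ (-(18 : ℝ)) with hr
  have hr0 : 0 < r := Real.rpow_pos_of_pos hb _
  have hr1 : r < 1 := Real.rpow_lt_one_of_one_lt_of_neg hb1' (by norm_num)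
  have hsum : Summable fun j : ℕ => r ^ j := summable_geometric_of_lt_one hr0.le hr1
  have htsum : ∑' j : ℕ, r ^ j = (1 - r)⁻¹ := tsum_geometric_of_lt_one hr0.le hr1
  set C : ℝ := (m : ℝ) / 2 * δ ^ 2 * (1 - r)⁻¹ with hC
  refine exists_viscousGlobal_of_subcriticalEnvelope (η := 17) hε.le (by norm_num) hν hMα hα X₀ fun T hT =>
    ⟨C, fun s hs X hinit hnoLow hapr hcont hderiv n N hnN t ht => ?_⟩
  -- the persistent envelope on `[0,s]`
  have henv := envelope_persists hε hδ hα hsmall hX₀ hs.1.le hinit hnoLow hapr hcont hderiv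
  -- per-shell energy bound `Σ_i ½ X_{i,k}² ≤ (m/2) δ² r^k`
  have hpow : ∀ k : ℕ, ((1 + ε₀) ^ (-((9 : ℝ) * ((k : ℤ) : ℝ)))) ^ 2 = r ^ k := by
    intro k
    rw [← Real.rpow_natCast ((1 + ε₀) ^ (-((9 : ℝ) * ((k : ℤ) : ℝ)))) 2, ← Real.rpow_mul hb.le, hr,
      ← Real.rpow_mul_natCast hb.le]
    congr 1
    push_cast
    ring
  have hshell : ∀ k : ℕ, ∑ i, (1 / 2) * X i (k : ℤ) t ^ 2 ≤ (m : ℝ) / 2 * δ ^ 2 * r ^ k := by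
    intro k
    have hterm : ∀ i, (1 / 2) * X i (k : ℤ) t ^ 2 ≤ (1 / 2) * (δ ^ 2 * r ^ k) := by
      intro i
      have h1 := henv i (k : ℤ) t ht
      have hnn : 0 ≤ δ * (1 + ε₀) ^ (-((9 : ℝ) * ((k : ℤ) : ℝ))) := mul_nonneg hδ.le (Real.rpow_nonneg hb.le _)
      have h2 : X i (k : ℤ) t ^ 2 ≤ (δ * (1 + ε₀) ^ (-((9 : ℝ) * ((k : ℤ) : ℝ)))) ^ 2 := by
        rw [← sq_abs (X i (k : ℤ) t)]
        exact pow_le_pow_left₀ (abs_nonneg _) h1 2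
      rw [mul_pow, hpow k] at h2
      linarith
    calc ∑ i, (1 / 2) * X i (k : ℤ) t ^ 2 ≤ ∑ _i : Fin m, (1 / 2) * (δ ^ 2 * r ^ k) :=
          Finset.sum_le_sum fun i _ => hterm i
      _ = (m : ℝ) / 2 * δ ^ 2 * r ^ k := by
          rw [Finset.sum_const, Finset.card_univ, Fintype.card_fin, nsmul_eq_mul]; ring
  -- geometric tail: `Σ_{k=n}^{N} r^k ≤ r^n (1-r)⁻¹`
  have hIcc : Finset.Icc n N = Finset.Ico n (N + 1) := by
    ext k; simp only [Finset.mem_Icc, Finset.mem_Ico]; omega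
  have htail : ∑ k ∈ Finset.Icc n N, r ^ k ≤ r ^ n * (1 - r)⁻¹ := by
    rw [hIcc, Finset.sum_Ico_eq_sum_range]
    have : ∑ j ∈ Finset.range (N + 1 - n), r ^ (n + j) = r ^ n * ∑ j ∈ Finset.range (N + 1 - n), r ^ j := by
      rw [Finset.mul_sum]
      exact Finset.sum_congr rfl fun j _ => pow_add r n j
    rw [this, ← htsum]
    exact mul_le_mul_of_nonneg_left
      (hsum.sum_le_tsum (Finset.range (N + 1 - n)) fun j _ => pow_nonneg hr0.le j) (pow_nonneg hr0.le n)
  -- `r^n = (1+ε₀)^{-(1+17) n}`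
  have hrn : r ^ n = (1 + ε₀) ^ (-((1 + 17) * (n : ℝ))) := by
    rw [hr, ← Real.rpow_mul_natCast hb.le]
    congr 1
    ring
  calc ∑ k ∈ Finset.Icc n N, ∑ i, (1 / 2) * X i (k : ℤ) t ^ 2
      ≤ ∑ k ∈ Finset.Icc n N, (m : ℝ) / 2 * δ ^ 2 * r ^ k := Finset.sum_le_sum fun k _ => hshell k
    _ = (m : ℝ) / 2 * δ ^ 2 * ∑ k ∈ Finset.Icc n N, r ^ k := by rw [Finset.mul_sum]
    _ ≤ (m : ℝ) / 2 * δ ^ 2 * (r ^ n * (1 - r)⁻¹) := mul_le_mul_of_nonneg_left htail (by positivity)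
    _ = C * (1 + ε₀) ^ (-((1 + 17) * (n : ℝ))) := by rw [hC, ← hrn]; ring

/-- **LARGE VISCOSITY, GENERAL TABLE, EXPLICIT THRESHOLD** (the same theorem read at a fixed datum): for `ε₀ > 0`,
`|α| ≤ M_α` and ANY one-shell datum `X₀`, the `ν`-viscous lattice has a global regular solution from `X₀` as soon as
`ν > 8 m² M_α (1+ε₀)^{16} (2‖X₀‖ + 1)` (sup norm) — `exists_viscousGlobal_of_smallDatum` with `δ = 2‖X₀‖ + 1`. For
tables of `E₂(R)` (`M_α = 1`, `m = 4`) this is the dissipation-dominated regime `largeNuRegular` of route WakeRatchet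
(stub S1 of ⟨22743⟩, `WakeRatchetMinimalViscousBlowupLargeNuRegular`, threshold `32 m² λ² (2Σ|X₀ᵢ|+1)`), whose invariant-region
bootstrap this module re-derives with the weight `(1+ε₀)^{-9k}` and a fence instead of a Duhamel bound — HONEST OVERLAP:
the mechanism is the tree's (BMR §3.1), only the packaging (fixed `ν` / small datum, general `m`, `M_α`) differs.
[cite: Tao2016AveragedNS, §4 Lemma 4.1 (4.5)–(4.11) and the viscous lattice before Thm. 4.2; BarbatoMorandinRomito2011, §3.1 Prop. 3.3, §3.2] -/
theorem exists_viscousGlobal_of_largeNu {ε₀ ν Mα : ℝ} (hε : 0 < ε₀) (hMα : 0 ≤ Mα)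
    {α : Fin m → Fin m → Fin m → ℤ × ℤ × ℤ → ℝ} (hα : ∀ i₁ i₂ i₃ μ, |α i₁ i₂ i₃ μ| ≤ Mα)
    (X₀ : Fin m → ℝ) (hν : 8 * (m : ℝ) ^ 2 * Mα * (1 + ε₀) ^ (16 : ℝ) * (2 * ‖X₀‖ + 1) < ν) :
    ∃ X : Fin m → ℤ → ℝ → ℝ, ViscousGlobal ε₀ ν α X₀ X := by
  have hδ : 0 < 2 * ‖X₀‖ + 1 := by positivity
  have hνpos : 0 < ν := lt_of_le_of_lt (by positivity) hν
  exact exists_viscousGlobal_of_smallDatum hε hνpos hMα hδ hα hν fun i => by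
    have := norm_le_pi_norm X₀ i
    rw [Real.norm_eq_abs] at this
    linarith

end BlowupRigidityOne

end Summit.NavierStokesRegularity.NavierStokesRegularity.Theorems

end
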